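import Mathlib
import Literature.Analysis.FluidPDE.VectorCalculus
import Literature.Analysis.FluidPDE.SelfSimilarEulerProfile
import Literature.Analysis.FluidPDE.SelfSimilarEulerProfileVorticity
import Summits.NavierStokesRegularity.NavierStokesRegularity.Theorems.EulerZoomLiouvillePowerGaugeEulerLiouvilleEnstrophyWeightedFlux
import Summits.NavierStokesRegularity.NavierStokesRegularity.Theorems.EulerZoomLiouvillePowerGaugeEulerLiouvilleSmallMomentTools
import Summits.NavierStokesRegularity.NavierStokesRegularity.Theorems.EulerZoomLiouvillePowerGaugeEulerLiouvilleWeakCasimirRaceTools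
import HarnessLib

/-!
# t56-SM, step 1–2: THE ENSTROPHY-MOMENT FLUX IDENTITY AT A FIXED SCALE (ε → 0 done)
# (nsreg-p2 ROUND-52 §E / SEEDS-R53 S2 key 06:31:13Z; ezl-w3 g7 feasibility note `ns-ezl-w3-t56-SM-feasibility-g7.md` fd09e649b512eb91, steps 1–2;
# seat ns-sfl-p1 g9, `--supports stmt-NavierStokesRegularity-19832 --as helper`)

For a `C²` self-similar Euler profile `(γ, 0, V, P)` with vorticity `Ω = curl V`, wind `W = γy + V`, the radial cut-off
`ψ_s(y) = σ(2 − ‖y‖²/s²)` (`σ = Real.smoothTransition`, ezl-w2's `psiR`) and every `0 < p < 1`, `s > 0`: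
`∫ (‖Ω‖²)^p · Dψ_s[W] = −∫ ψ_s · ((3γ − 2p)(‖Ω‖²)^p + 2p (‖Ω‖²)^{p−1}⟪Ω, DV Ω⟫)`  (`limit_identity`).
Proof: the landed E5 identity `ClassicalProfile.divergence_enstrophyWeight_transport` with the smooth weight `ψ_ε(t) = (t² + ε²)^{p/2}`, tested
against `ψ_s` by the whole-space integration by parts `SmallMoment.integral_inner_gradient_eq_neg_integral_mul_divergence` (T1), then `ε → 0⁺`
by dominated convergence on the compact support of `ψ_s` (dominants `((‖Ω‖²)^p + 1)|Dψ_s[W]|` and `ψ_s(3|γ|((‖Ω‖²)^p+1) + 2p((‖Ω‖²)^p‖DV‖ + (‖Ω‖²)^p))`,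
using `t(t²+ε²)^{p/2−1} ≤ t^{p−1}` and `|⟪Ω, DVΩ⟫| ≤ ‖Ω‖²‖DV‖`).

HONEST FRAMING: class-free calculus for an UPPER-bound instrument at the self-similar borderline rate (SEEDS-R53 S2); nothing about the
crux E (19832 OPEN) or NS regularity is proved here. [nsreg-p2 R52 §E; folklore]
-/

noncomputable section

set_option linter.dupNamespace false

open Set Filter Topology Metric Function MeasureTheory InnerProductSpace
open scoped Topology ENNReal RealInnerProductSpace

namespace Summit.NavierStokesRegularity.NavierStokesRegularity.Theorems.PowerGaugeEulerLiouville

open Literature.Analysis Literature.Analysis.FluidPDE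

namespace SmallMoment

/-! ## The regularised power `ψ_ε(t) = (t² + ε²)^{p/2}` -/

/-- `ψ_ε` is smooth for `ε ≠ 0`. [folklore] -/
theorem contDiff_psiEps {ε : ℝ} (hε : ε ≠ 0) (p : ℝ) {n : ℕ∞} :
    ContDiff ℝ n (fun t : ℝ => (t ^ 2 + ε ^ 2) ^ (p / 2)) :=
  ((contDiff_id.pow 2).add contDiff_const).rpow_const_of_ne fun t => by positivity

/-- `ψ_ε′(t) = p·t·(t² + ε²)^{p/2 − 1}`. [folklore] -/
theorem hasDerivAt_psiEps {ε : ℝ} (hε : ε ≠ 0) (p t : ℝ) :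
    HasDerivAt (fun t : ℝ => (t ^ 2 + ε ^ 2) ^ (p / 2)) (p * t * (t ^ 2 + ε ^ 2) ^ (p / 2 - 1)) t := by
  have h : HasDerivAt (fun t : ℝ => t ^ 2 + ε ^ 2) (2 * t) t := by
    simpa using (hasDerivAt_pow 2 t).add_const (ε ^ 2)
  have h2 := h.rpow_const (p := p / 2) (Or.inl (by positivity))
  convert h2 using 1
  ring

/-- `deriv ψ_ε`. [folklore] -/
theorem deriv_psiEps {ε : ℝ} (hε : ε ≠ 0) (p t : ℝ) :
    deriv (fun t : ℝ => (t ^ 2 + ε ^ 2) ^ (p / 2)) t = p * t * (t ^ 2 + ε ^ 2) ^ (p / 2 - 1) :=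
  (hasDerivAt_psiEps hε p t).deriv

/-- `ψ_ε(t) ≤ t^p + 1` for `t ≥ 0`, `0 ≤ p ≤ 2`, `|ε| ≤ 1` (subadditivity of `x ↦ x^{p/2}`). [folklore] -/
theorem psiEps_le {ε p t : ℝ} (hp : 0 ≤ p) (hp2 : p ≤ 2) (ht : 0 ≤ t) (hε : |ε| ≤ 1) :
    (t ^ 2 + ε ^ 2) ^ (p / 2) ≤ t ^ p + 1 := by
  have h := Real.rpow_add_le_add_rpow (sq_nonneg t) (sq_nonneg ε) (by positivity : 0 ≤ p / 2) (by linarith)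
  have e1 : (t ^ 2) ^ (p / 2) = t ^ p := by
    rw [← Real.rpow_natCast t 2, ← Real.rpow_mul ht]; push_cast; ring_nf
  have e2 : (ε ^ 2) ^ (p / 2) ≤ 1 := by
    rw [← sq_abs, ← Real.rpow_natCast |ε| 2, ← Real.rpow_mul (abs_nonneg ε)]
    exact Real.rpow_le_one (abs_nonneg ε) hε (by push_cast; positivity)
  linarith [h, e1, e2]

/-- `t·(t² + ε²)^{p/2 − 1} ≤ t^{p−1}` for `t > 0`, `p ≤ 2`. [folklore] -/
theorem mul_psiEps_deriv_core_le {ε p t : ℝ} (hp2 : p ≤ 2) (ht : 0 < t) :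
    t * (t ^ 2 + ε ^ 2) ^ (p / 2 - 1) ≤ t ^ (p - 1) := by
  have h1 : (t ^ 2 + ε ^ 2) ^ (p / 2 - 1) ≤ (t ^ 2) ^ (p / 2 - 1) :=
    Real.rpow_le_rpow_of_nonpos (by positivity) (by nlinarith [sq_nonneg ε]) (by linarith)
  have e : t * (t ^ 2) ^ (p / 2 - 1) = t ^ (p - 1) := by
    rw [← Real.rpow_natCast t 2, ← Real.rpow_mul ht.le, show ((2 : ℕ) : ℝ) * (p / 2 - 1) = p - 2 by push_cast; ring]
    conv_lhs => rw [show t * t ^ (p - 2) = t ^ (1 : ℝ) * t ^ (p - 2) by rw [Real.rpow_one]]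
    rw [← Real.rpow_add ht]; ring_nf
  calc t * (t ^ 2 + ε ^ 2) ^ (p / 2 - 1) ≤ t * (t ^ 2) ^ (p / 2 - 1) := mul_le_mul_of_nonneg_left h1 ht.le
    _ = t ^ (p - 1) := e

/-- The stretching density bound: `|2ψ_ε′(t)(S − t)| ≤ 2p(t^p·K + t^p)` whenever `t ≥ 0`, `|S| ≤ t·K`, `K ≥ 0`, `0 < p ≤ 2`, `ε ≠ 0`
(at `t = 0` the left side vanishes). [folklore] -/
theorem abs_stretch_density_le {ε p t S K : ℝ} (hε : ε ≠ 0) (hp : 0 < p) (hp2 : p ≤ 2) (ht : 0 ≤ t) (hK : 0 ≤ K)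
    (hS : |S| ≤ t * K) :
    |2 * (p * t * (t ^ 2 + ε ^ 2) ^ (p / 2 - 1)) * (S - t)| ≤ 2 * p * (t ^ p * K + t ^ p) := by
  rcases eq_or_lt_of_le ht with h0 | h0
  · subst h0
    simp only [mul_zero, zero_mul, abs_zero]
    positivity
  · have hcore := mul_psiEps_deriv_core_le (ε := ε) hp2 h0
    have hpos : 0 ≤ t * (t ^ 2 + ε ^ 2) ^ (p / 2 - 1) := by positivity
    have hSt : |S - t| ≤ t * K + t := by
      calc |S - t| ≤ |S| + |t| := abs_sub _ _
        _ ≤ t * K + t := by rw [abs_of_pos h0]; linarith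
    have e : t ^ (p - 1) * (t * K + t) = t ^ p * K + t ^ p := by
      have : t ^ (p - 1) * t = t ^ p := by
        conv_lhs => rw [show t ^ (p - 1) * t = t ^ (p - 1) * t ^ (1 : ℝ) by rw [Real.rpow_one]]
        rw [← Real.rpow_add h0]; ring_nf
      calc t ^ (p - 1) * (t * K + t) = (t ^ (p - 1) * t) * K + t ^ (p - 1) * t := by ring
        _ = t ^ p * K + t ^ p := by rw [this]
    calc |2 * (p * t * (t ^ 2 + ε ^ 2) ^ (p / 2 - 1)) * (S - t)|
        = 2 * p * (t * (t ^ 2 + ε ^ 2) ^ (p / 2 - 1)) * |S - t| := by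
          rw [abs_mul, show 2 * (p * t * (t ^ 2 + ε ^ 2) ^ (p / 2 - 1)) = (2 * p) * (t * (t ^ 2 + ε ^ 2) ^ (p / 2 - 1)) by ring,
            abs_of_nonneg (by positivity)]
      _ ≤ 2 * p * t ^ (p - 1) * (t * K + t) := by gcongr
      _ = 2 * p * (t ^ p * K + t ^ p) := by rw [mul_assoc, e]

/-- Pointwise limits as `ε → 0⁺`: `ψ_ε(t) → t^p` (`t ≥ 0`, `p > 0`). [folklore] -/
theorem tendsto_psiEps {p t : ℝ} (hp : 0 < p) (ht : 0 ≤ t) :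
    Tendsto (fun ε : ℝ => (t ^ 2 + ε ^ 2) ^ (p / 2)) (𝓝[>] 0) (𝓝 (t ^ p)) := by
  have h1 : Tendsto (fun ε : ℝ => t ^ 2 + ε ^ 2) (𝓝[>] 0) (𝓝 (t ^ 2)) := by
    have : Tendsto (fun ε : ℝ => t ^ 2 + ε ^ 2) (𝓝 0) (𝓝 (t ^ 2 + 0 ^ 2)) :=
      (continuous_const.add (continuous_id.pow 2)).tendsto 0
    simpa using this.mono_left nhdsWithin_le_nhds
  have h2 := h1.rpow_const (p := p / 2) (Or.inr (by positivity))
  have e : (t ^ 2) ^ (p / 2) = t ^ p := by rw [← Real.rpow_natCast t 2, ← Real.rpow_mul ht]; push_cast; ring_nf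
  rwa [e] at h2

/-- Pointwise limits as `ε → 0⁺`: `2ψ_ε′(t)(S − t) → 2p(t^{p−1}S − t^p)` (`t ≥ 0`, `0 < p < 1`; both sides vanish at `t = 0`). [folklore] -/
theorem tendsto_stretch_density {p t S : ℝ} (hp : 0 < p) (hp1 : p < 1) (ht : 0 ≤ t) :
    Tendsto (fun ε : ℝ => 2 * (p * t * (t ^ 2 + ε ^ 2) ^ (p / 2 - 1)) * (S - t)) (𝓝[>] 0)
      (𝓝 (2 * p * (t ^ (p - 1) * S - t ^ p))) := by
  rcases eq_or_lt_of_le ht with h0 | h0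
  · subst h0
    have e1 : (0 : ℝ) ^ (p - 1) = 0 := Real.zero_rpow (by linarith)
    have e2 : (0 : ℝ) ^ p = 0 := Real.zero_rpow hp.ne'
    simp only [mul_zero, zero_mul, e1, e2, sub_self]
    exact tendsto_const_nhds
  · have h1 : Tendsto (fun ε : ℝ => t ^ 2 + ε ^ 2) (𝓝[>] 0) (𝓝 (t ^ 2)) := by
      have : Tendsto (fun ε : ℝ => t ^ 2 + ε ^ 2) (𝓝 0) (𝓝 (t ^ 2 + 0 ^ 2)) :=
        (continuous_const.add (continuous_id.pow 2)).tendsto 0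
      simpa using this.mono_left nhdsWithin_le_nhds
    have h2 := h1.rpow_const (p := p / 2 - 1) (Or.inl (by positivity))
    have e : t * (t ^ 2) ^ (p / 2 - 1) = t ^ (p - 1) := by
      rw [← Real.rpow_natCast t 2, ← Real.rpow_mul h0.le, show ((2 : ℕ) : ℝ) * (p / 2 - 1) = p - 2 by push_cast; ring]
      conv_lhs => rw [show t * t ^ (p - 2) = t ^ (1 : ℝ) * t ^ (p - 2) by rw [Real.rpow_one]]
      rw [← Real.rpow_add h0]; ring_nf
    have e' : t ^ (p - 1) * t = t ^ p := by
      conv_lhs => rw [show t ^ (p - 1) * t = t ^ (p - 1) * t ^ (1 : ℝ) by rw [Real.rpow_one]]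
      rw [← Real.rpow_add h0]; ring_nf
    have h3 : Tendsto (fun ε : ℝ => 2 * (p * t * (t ^ 2 + ε ^ 2) ^ (p / 2 - 1)) * (S - t)) (𝓝[>] 0)
        (𝓝 (2 * (p * t * (t ^ 2) ^ (p / 2 - 1)) * (S - t))) :=
      ((h2.const_mul (p * t)).const_mul 2).mul_const (S - t)
    have e3 : 2 * (p * t * (t ^ 2) ^ (p / 2 - 1)) * (S - t) = 2 * p * (t ^ (p - 1) * S - t ^ p) := by
      rw [show p * t * (t ^ 2) ^ (p / 2 - 1) = p * (t * (t ^ 2) ^ (p / 2 - 1)) by ring, e, ← e']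
      ring
    rwa [e3] at h3


/-! ## The flux identity at `(s, ε)` -/

section Profile

variable {γ : ℝ} {V : EuclideanSpace ℝ (Fin 3) → EuclideanSpace ℝ (Fin 3)} {P : EuclideanSpace ℝ (Fin 3) → ℝ}

/-- `Ω = curl V` is `C¹` for a `C²` field. [folklore] -/
theorem contDiff_one_curl (hV : ContDiff ℝ 2 V) : ContDiff ℝ 1 (curl V) := by
  rw [curl_eq_curlCLM_comp]
  exact curlCLM.contDiff.comp (hV.fderiv_right (m := 1) le_rfl)

/-- The wind `W = γy + V` is `C¹` (indeed `C²`). [folklore] -/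
theorem contDiff_one_transport (hV : ContDiff ℝ 2 V) : ContDiff ℝ 1 (selfSimilarTransport γ 0 V) := by
  have e : selfSimilarTransport γ 0 V = fun y => γ • (y - 0) + V y := by funext y; rfl
  rw [e]
  exact ((contDiff_id.sub contDiff_const).const_smul γ).add (hV.of_le (by norm_cast))

/-- `Dψ_s` vanishes off the closed ball `B̄(0, 2s)`, hence `y ↦ Dψ_s(y)[F y]` has compact support. [folklore] -/
theorem hasCompactSupport_fderiv_psiR_apply {s : ℝ} (hs : 0 < s)
    (F : EuclideanSpace ℝ (Fin 3) → EuclideanSpace ℝ (Fin 3)) :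
    HasCompactSupport (fun y : EuclideanSpace ℝ (Fin 3) =>
      fderiv ℝ (fun y : EuclideanSpace ℝ (Fin 3) => Real.smoothTransition (2 - (s ^ 2)⁻¹ * ‖y‖ ^ 2)) y (F y)) := by
  refine HasCompactSupport.of_support_subset_isCompact (isCompact_closedBall (0 : EuclideanSpace ℝ (Fin 3)) (2 * s)) ?_
  intro y hy
  rw [mem_closedBall, dist_zero_right]
  by_contra h
  exact hy (WeakAxisym.fderiv_psiR_apply_eq_zero hs (not_le.1 h).le (F y))

/-- `ψ_s` has compact support inside `B̄(0, 2s)` (ezl-w2). [folklore] -/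
theorem tsupport_psiR_subset {s : ℝ} (hs : 0 < s) :
    Function.support (fun y : EuclideanSpace ℝ (Fin 3) => Real.smoothTransition (2 - (s ^ 2)⁻¹ * ‖y‖ ^ 2)) ⊆
      closedBall (0 : EuclideanSpace ℝ (Fin 3)) (2 * s) := by
  intro y hy
  rw [mem_closedBall, dist_zero_right]
  by_contra h
  exact hy (WeakAxisym.psiR_eq_zero_of_le hs (not_le.1 h).le)

/-- **The tested E5 identity at `(s, ε)`**: `∫ ψ_ε(‖Ω‖²)·Dψ_s[W] = −∫ ψ_s(3γψ_ε(‖Ω‖²) + 2ψ_ε′(‖Ω‖²)(⟪Ω,DVΩ⟫ − ‖Ω‖²))`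
(E5 `ClassicalProfile.divergence_enstrophyWeight_transport` + T1 `integral_inner_gradient_eq_neg_integral_mul_divergence`). [nsreg-p2 R52 §E; folklore] -/
theorem flux_identity_eps (hprof : IsSelfSimilarEulerProfile γ 0 V P) (p : ℝ) {ε s : ℝ} (hε : ε ≠ 0) (hs : 0 < s) :
    ∫ y, ((‖curl V y‖ ^ 2) ^ 2 + ε ^ 2) ^ (p / 2) *
        fderiv ℝ (fun y : EuclideanSpace ℝ (Fin 3) => Real.smoothTransition (2 - (s ^ 2)⁻¹ * ‖y‖ ^ 2)) y
          (selfSimilarTransport γ 0 V y) =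
      -∫ y, Real.smoothTransition (2 - (s ^ 2)⁻¹ * ‖y‖ ^ 2) *
          (3 * γ * ((‖curl V y‖ ^ 2) ^ 2 + ε ^ 2) ^ (p / 2) +
            2 * (p * ‖curl V y‖ ^ 2 * ((‖curl V y‖ ^ 2) ^ 2 + ε ^ 2) ^ (p / 2 - 1)) *
              (⟪curl V y, fderiv ℝ V y (curl V y)⟫ - ‖curl V y‖ ^ 2)) := by
  have hψ : ContDiff ℝ 1 (fun t : ℝ => (t ^ 2 + ε ^ 2) ^ (p / 2)) := contDiff_psiEps hε p
  have hΩ : ContDiff ℝ 1 (curl V) := contDiff_one_curl hprof.contDiff_velocity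
  have hW : ContDiff ℝ 1 (selfSimilarTransport γ 0 V) := contDiff_one_transport hprof.contDiff_velocity
  have hF : ContDiff ℝ 1 (fun x => (fun t : ℝ => (t ^ 2 + ε ^ 2) ^ (p / 2)) (‖curl V x‖ ^ 2) • selfSimilarTransport γ 0 V x) :=
    (hψ.comp (hΩ.norm_sq ℝ)).smul hW
  have hT1 := integral_inner_gradient_eq_neg_integral_mul_divergence hF (WeakAxisym.contDiff_psiR s)
    (WeakAxisym.hasCompactSupport_psiR hs)
  -- rewrite the left integrand `⟪F, ∇ψ_s⟫ = ψ_ε · Dψ_s[W]` and the divergence by E5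
  have hL : ∀ y, ⟪(fun t : ℝ => (t ^ 2 + ε ^ 2) ^ (p / 2)) (‖curl V y‖ ^ 2) • selfSimilarTransport γ 0 V y,
      gradient (fun y : EuclideanSpace ℝ (Fin 3) => Real.smoothTransition (2 - (s ^ 2)⁻¹ * ‖y‖ ^ 2)) y⟫ =
      ((‖curl V y‖ ^ 2) ^ 2 + ε ^ 2) ^ (p / 2) *
        fderiv ℝ (fun y : EuclideanSpace ℝ (Fin 3) => Real.smoothTransition (2 - (s ^ 2)⁻¹ * ‖y‖ ^ 2)) y
          (selfSimilarTransport γ 0 V y) := by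
    intro y
    rw [gradient, real_inner_comm, InnerProductSpace.toDual_symm_apply, map_smul, smul_eq_mul]
  have hR : ∀ y, VectorCalculus.divergence
      (fun x => (fun t : ℝ => (t ^ 2 + ε ^ 2) ^ (p / 2)) (‖curl V x‖ ^ 2) • selfSimilarTransport γ 0 V x) y =
      3 * γ * ((‖curl V y‖ ^ 2) ^ 2 + ε ^ 2) ^ (p / 2) +
        2 * (p * ‖curl V y‖ ^ 2 * ((‖curl V y‖ ^ 2) ^ 2 + ε ^ 2) ^ (p / 2 - 1)) *
          (⟪curl V y, fderiv ℝ V y (curl V y)⟫ - ‖curl V y‖ ^ 2) := by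
    intro y
    rw [ClassicalProfile.divergence_enstrophyWeight_transport hprof hψ y, deriv_psiEps hε]
  simp_rw [hL, hR] at hT1
  exact hT1


/-! ## The limit `ε → 0⁺` -/

/-- `|⟪Ω, DV Ω⟫| ≤ ‖Ω‖²·‖DV‖`. [folklore] -/
theorem abs_inner_fderiv_apply_le (y : EuclideanSpace ℝ (Fin 3)) :
    |⟪curl V y, fderiv ℝ V y (curl V y)⟫| ≤ ‖curl V y‖ ^ 2 * ‖fderiv ℝ V y‖ := by
  calc |⟪curl V y, fderiv ℝ V y (curl V y)⟫| ≤ ‖curl V y‖ * ‖fderiv ℝ V y (curl V y)‖ := abs_real_inner_le_norm _ _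
    _ ≤ ‖curl V y‖ * (‖fderiv ℝ V y‖ * ‖curl V y‖) := by gcongr; exact (fderiv ℝ V y).le_opNorm _
    _ = ‖curl V y‖ ^ 2 * ‖fderiv ℝ V y‖ := by ring

/-- ★ **THE ENSTROPHY-MOMENT FLUX IDENTITY AT SCALE `s`** (t56-SM steps 1–2; `ε → 0` done): for a `C²` profile `(γ, 0, V, P)`,
`0 < p < 1`, `s > 0`,
`∫ (‖Ω‖²)^p·Dψ_s[W] = −∫ ψ_s·((3γ − 2p)(‖Ω‖²)^p + 2p·(‖Ω‖²)^{p−1}⟪Ω, DVΩ⟫)`, `ψ_s(y) = σ(2 − ‖y‖²/s²)`, `W = γy + V`, `Ω = curl V`.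
[nsreg-p2 R52 §E / SEEDS-R53 S2; folklore] -/
theorem limit_identity (hprof : IsSelfSimilarEulerProfile γ 0 V P) {p : ℝ} (hp : 0 < p) (hp1 : p < 1) {s : ℝ} (hs : 0 < s) :
    ∫ y, (‖curl V y‖ ^ 2) ^ p *
        fderiv ℝ (fun y : EuclideanSpace ℝ (Fin 3) => Real.smoothTransition (2 - (s ^ 2)⁻¹ * ‖y‖ ^ 2)) y
          (selfSimilarTransport γ 0 V y) =
      -∫ y, Real.smoothTransition (2 - (s ^ 2)⁻¹ * ‖y‖ ^ 2) *
          ((3 * γ - 2 * p) * (‖curl V y‖ ^ 2) ^ p +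
            2 * p * ((‖curl V y‖ ^ 2) ^ (p - 1) * ⟪curl V y, fderiv ℝ V y (curl V y)⟫)) := by
  have hV2 : ContDiff ℝ 2 V := hprof.contDiff_velocity
  have hΩc : Continuous (curl V) := (contDiff_one_curl hV2).continuous
  have hDVc : Continuous (fderiv ℝ V) := hV2.continuous_fderiv (by norm_cast)
  have hWc : Continuous (selfSimilarTransport γ 0 V) := (contDiff_one_transport (γ := γ) hV2).continuous
  have htc : Continuous fun y => ‖curl V y‖ ^ 2 := hΩc.norm.pow 2
  have htp : Continuous fun y => (‖curl V y‖ ^ 2) ^ p := htc.rpow_const fun y => Or.inr hp.le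
  -- the cut-off, its derivative along `W`, and compact support
  have hψc : Continuous (fun y : EuclideanSpace ℝ (Fin 3) => Real.smoothTransition (2 - (s ^ 2)⁻¹ * ‖y‖ ^ 2)) :=
    (WeakAxisym.contDiff_psiR s (n := 1)).continuous
  have hDψc : Continuous (fun y : EuclideanSpace ℝ (Fin 3) =>
      fderiv ℝ (fun y : EuclideanSpace ℝ (Fin 3) => Real.smoothTransition (2 - (s ^ 2)⁻¹ * ‖y‖ ^ 2)) y
        (selfSimilarTransport γ 0 V y)) :=
    ((WeakAxisym.contDiff_psiR s (n := 1)).continuous_fderiv one_ne_zero).clm_apply hWc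
  have hDψsupp := hasCompactSupport_fderiv_psiR_apply hs (selfSimilarTransport γ 0 V)
  have hψsupp : HasCompactSupport (fun y : EuclideanSpace ℝ (Fin 3) => Real.smoothTransition (2 - (s ^ 2)⁻¹ * ‖y‖ ^ 2)) :=
    WeakAxisym.hasCompactSupport_psiR hs
  -- ε ranges over `(0, 1)` eventually
  have hev : ∀ᶠ ε in 𝓝[>] (0 : ℝ), 0 < ε ∧ ε < 1 := by
    filter_upwards [Ioo_mem_nhdsGT (zero_lt_one' ℝ)] with ε hε using hε
  -- (1) the left-hand sides converge
  have hL : Tendsto (fun ε : ℝ => ∫ y, ((‖curl V y‖ ^ 2) ^ 2 + ε ^ 2) ^ (p / 2) *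
        fderiv ℝ (fun y : EuclideanSpace ℝ (Fin 3) => Real.smoothTransition (2 - (s ^ 2)⁻¹ * ‖y‖ ^ 2)) y
          (selfSimilarTransport γ 0 V y)) (𝓝[>] 0)
      (𝓝 (∫ y, (‖curl V y‖ ^ 2) ^ p *
        fderiv ℝ (fun y : EuclideanSpace ℝ (Fin 3) => Real.smoothTransition (2 - (s ^ 2)⁻¹ * ‖y‖ ^ 2)) y
          (selfSimilarTransport γ 0 V y))) := by
    refine tendsto_integral_filter_of_dominated_convergence
      (fun y => ((‖curl V y‖ ^ 2) ^ p + 1) *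
        |fderiv ℝ (fun y : EuclideanSpace ℝ (Fin 3) => Real.smoothTransition (2 - (s ^ 2)⁻¹ * ‖y‖ ^ 2)) y
          (selfSimilarTransport γ 0 V y)|) ?_ ?_ ?_ ?_
    · refine Eventually.of_forall fun ε => Continuous.aestronglyMeasurable ?_
      exact ((htc.pow 2).add continuous_const |>.rpow_const fun y => Or.inr (by positivity)).mul hDψc
    · filter_upwards [hev] with ε hε
      refine ae_of_all _ fun y => ?_
      rw [Real.norm_eq_abs, abs_mul, abs_of_nonneg (Real.rpow_nonneg (by positivity) _)]
      exact mul_le_mul_of_nonneg_right (psiEps_le hp.le (by linarith) (sq_nonneg _) (by rw [abs_of_pos hε.1]; exact hε.2.le))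
        (abs_nonneg _)
    · exact ((htp.add continuous_const).mul hDψc.abs).integrable_of_hasCompactSupport hDψsupp.abs.mul_left
    · refine ae_of_all _ fun y => ?_
      exact (tendsto_psiEps hp (sq_nonneg _)).mul_const _
  -- (2) the right-hand sides converge
  have hR : Tendsto (fun ε : ℝ => -∫ y, Real.smoothTransition (2 - (s ^ 2)⁻¹ * ‖y‖ ^ 2) *
        (3 * γ * ((‖curl V y‖ ^ 2) ^ 2 + ε ^ 2) ^ (p / 2) +
          2 * (p * ‖curl V y‖ ^ 2 * ((‖curl V y‖ ^ 2) ^ 2 + ε ^ 2) ^ (p / 2 - 1)) *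
            (⟪curl V y, fderiv ℝ V y (curl V y)⟫ - ‖curl V y‖ ^ 2))) (𝓝[>] 0)
      (𝓝 (-∫ y, Real.smoothTransition (2 - (s ^ 2)⁻¹ * ‖y‖ ^ 2) *
        (3 * γ * (‖curl V y‖ ^ 2) ^ p +
          2 * p * ((‖curl V y‖ ^ 2) ^ (p - 1) * ⟪curl V y, fderiv ℝ V y (curl V y)⟫ - (‖curl V y‖ ^ 2) ^ p)))) := by
    refine (tendsto_integral_filter_of_dominated_convergence
      (fun y => Real.smoothTransition (2 - (s ^ 2)⁻¹ * ‖y‖ ^ 2) *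
        (3 * |γ| * ((‖curl V y‖ ^ 2) ^ p + 1) +
          2 * p * ((‖curl V y‖ ^ 2) ^ p * ‖fderiv ℝ V y‖ + (‖curl V y‖ ^ 2) ^ p))) ?_ ?_ ?_ ?_).neg
    · filter_upwards [hev] with ε hε
      refine Continuous.aestronglyMeasurable (hψc.mul ?_)
      have h1 : Continuous fun y => ((‖curl V y‖ ^ 2) ^ 2 + ε ^ 2) ^ (p / 2) :=
        ((htc.pow 2).add continuous_const).rpow_const fun y => Or.inr (by positivity)
      have h2 : Continuous fun y => ((‖curl V y‖ ^ 2) ^ 2 + ε ^ 2) ^ (p / 2 - 1) :=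
        ((htc.pow 2).add continuous_const).rpow_const fun y =>
          Or.inl (ne_of_gt (add_pos_of_nonneg_of_pos (sq_nonneg _) (pow_pos hε.1 2)))
      exact (continuous_const.mul h1).add
        ((continuous_const.mul ((continuous_const.mul htc).mul h2)).mul
          ((hΩc.inner (hDVc.clm_apply hΩc)).sub htc))
    · filter_upwards [hev] with ε hε
      refine ae_of_all _ fun y => ?_
      have hψ0 : 0 ≤ Real.smoothTransition (2 - (s ^ 2)⁻¹ * ‖y‖ ^ 2) := WeakAxisym.psiR_nonneg s y
      have ht0 : 0 ≤ ‖curl V y‖ ^ 2 := sq_nonneg _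
      have hA : |3 * γ * ((‖curl V y‖ ^ 2) ^ 2 + ε ^ 2) ^ (p / 2)| ≤ 3 * |γ| * ((‖curl V y‖ ^ 2) ^ p + 1) := by
        rw [abs_mul, abs_mul, abs_of_pos (by norm_num : (0 : ℝ) < 3), abs_of_nonneg (Real.rpow_nonneg (by positivity) _)]
        exact mul_le_mul_of_nonneg_left (psiEps_le hp.le (by linarith) ht0 (by rw [abs_of_pos hε.1]; exact hε.2.le))
          (by positivity)
      have hB := abs_stretch_density_le (ε := ε) (S := ⟪curl V y, fderiv ℝ V y (curl V y)⟫) hε.1.ne' hp (by linarith) ht0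
        (norm_nonneg (fderiv ℝ V y)) (abs_inner_fderiv_apply_le y)
      rw [Real.norm_eq_abs, abs_mul, abs_of_nonneg hψ0]
      exact mul_le_mul_of_nonneg_left ((abs_add_le _ _).trans (add_le_add hA hB)) hψ0
    · refine Continuous.integrable_of_hasCompactSupport ?_ hψsupp.mul_right
      exact hψc.mul ((continuous_const.mul (htp.add continuous_const)).add
        (continuous_const.mul ((htp.mul hDVc.norm).add htp)))
    · refine ae_of_all _ fun y => ?_
      exact (((tendsto_psiEps hp (sq_nonneg _)).const_mul (3 * γ)).add
        (tendsto_stretch_density (S := ⟪curl V y, fderiv ℝ V y (curl V y)⟫) hp hp1 (sq_nonneg _))).const_mul _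
  -- (3) the identity at each `ε > 0`, and uniqueness of limits
  have key : ∀ᶠ ε in 𝓝[>] (0 : ℝ), (∫ y, ((‖curl V y‖ ^ 2) ^ 2 + ε ^ 2) ^ (p / 2) *
        fderiv ℝ (fun y : EuclideanSpace ℝ (Fin 3) => Real.smoothTransition (2 - (s ^ 2)⁻¹ * ‖y‖ ^ 2)) y
          (selfSimilarTransport γ 0 V y)) =
      -∫ y, Real.smoothTransition (2 - (s ^ 2)⁻¹ * ‖y‖ ^ 2) *
        (3 * γ * ((‖curl V y‖ ^ 2) ^ 2 + ε ^ 2) ^ (p / 2) +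
          2 * (p * ‖curl V y‖ ^ 2 * ((‖curl V y‖ ^ 2) ^ 2 + ε ^ 2) ^ (p / 2 - 1)) *
            (⟪curl V y, fderiv ℝ V y (curl V y)⟫ - ‖curl V y‖ ^ 2)) := by
    filter_upwards [hev] with ε hε using flux_identity_eps hprof p hε.1.ne' hs
  have hlim := tendsto_nhds_unique (hR.congr' (key.mono fun ε h => h.symm)) hL
  rw [← hlim]
  congr 1
  refine integral_congr_ae (ae_of_all _ fun y => ?_)
  simp only
  ring

end Profile

end SmallMoment

end Summit.NavierStokesRegularity.NavierStokesRegularity.Theorems.PowerGaugeEulerLiouville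

end
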